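import Summits.CriticalPhenomena.CardyFormulaZ2.Theorems.CardyUSTContinuationKirchhoffExtremalLengthG02Cross1

/-!
# The separation constant of the cross (G02 discretisation)

Support file for `KirchhoffExtremalLength` (route CardyUSTContinuation of `CardyFormulaZ2`, item
stmt-CriticalPhenomena-11234), towards the upper half of `G02ModulusConvergence` (`…Defs.lean`).
Continuum bookkeeping for the crosscut argument ([GP19] §3; Steps 0–1 of the tree's
`SquareTiling.exists_exits_flux_eq`, isolated as lemmas):

* `exists_cross_constant`: one positive constant separating the pieces of the cross
  `Γ_V = A₁ ∪ ⋯ ∪ A₅`, `Γ_H = B₁ ∪ ⋯ ∪ B₅`, the Dirichlet arcs `0 ∪ 2`, the end points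
  `q_b = Γ_V 0`, `q_t = Γ_V 1`, and the exterior closing curves.
-/

noncomputable section

namespace Summit.CriticalPhenomena.CardyFormulaZ2.Theorems

namespace KirchhoffSlope

open Set Metric Filter Topology SimpleGraph
open Literature.Probability Literature.Probability.LatticeModels Literature.Probability.Percolation
open Literature.Probability.LatticeModels.SquareTiling (exists_pos_forall_lt_dist)
open Literature.Probability.RandomPlanarGeometry

variable {δ : ℝ}

/-! ### The separation constant of the cross -/

/-- **The separation constant of the cross.** For the cross data of a conformal rectangle (the
curves `Γ_V` from the open arc `1` to the open arc `3` and `Γ_H` between the open arcs `j_L`,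
`j_R`, `{j_L, j_R} = {0, 2}`, inside `Ω` except at their ends, straightened through `B̄(c₀, r) ⊆ Ω`,
with the disjointness of `SquareTiling.cross_separation`) and exterior closing curves `E_t`, `M`,
`E_b` at `q_t = Γ_V 1`, `q_b = Γ_V 0`, there is `η₀ > 0` such that: the outer pieces of `Γ_V` are
`η₀`-far from `Γ_H`; the outer pieces of `Γ_H` are `η₀`-far from `Γ_V`; the arcs `0 ∪ 2` are
`η₀`-far from `Γ_V`, from `q_b, q_t` and from the closing curves; `Γ_H` is `η₀`-far from `q_b, q_t`
and from the closing curves. [folklore] -/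
theorem exists_cross_constant (R : ConformalRectangle)
    {ΓV ΓH : ℝ → ℂ} {c₀ : ℂ} {r xs ys tᵢ tₒ sᵢ sₒ : ℝ} {jL jR : Fin 4}
    (hVc : ContinuousOn ΓV (Icc 0 1)) (hHc : ContinuousOn ΓH (Icc 0 1))
    (hV0 : ∃ σ ∈ Ioo (R.mark 1) (R.nextMark 1), ΓV 0 = R.boundary σ)
    (hV1 : ∃ σ ∈ Ioo (R.mark 3) (R.nextMark 3), ΓV 1 = R.boundary σ)
    (hH0 : ∃ σ ∈ Ioo (R.mark jL) (R.nextMark jL), ΓH 0 = R.boundary σ)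
    (hH1 : ∃ σ ∈ Ioo (R.mark jR) (R.nextMark jR), ΓH 1 = R.boundary σ)
    (hLR : (jL = 0 ∧ jR = 2) ∨ (jL = 2 ∧ jR = 0))
    (hVΩ : ∀ t ∈ Ioo (0 : ℝ) 1, ΓV t ∈ R.carrier) (hHΩ : ∀ s ∈ Ioo (0 : ℝ) 1, ΓH s ∈ R.carrier)
    (hballΩ : closedBall c₀ r ⊆ R.carrier)
    (htᵢ : 0 < tᵢ) (htᵢₒ : tᵢ < tₒ) (htₒ : tₒ < 1) (hsᵢ : 0 < sᵢ) (hsᵢₒ : sᵢ < sₒ) (hsₒ : sₒ < 1)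
    (hdisjA : Disjoint (ΓV '' Icc 0 tᵢ ∪ segment ℝ (ΓV tᵢ) ⟨xs, c₀.im - r / 2⟩ ∪ segment ℝ ⟨xs, c₀.im + r / 2⟩ (ΓV tₒ) ∪ ΓV '' Icc tₒ 1)
      (ΓH '' Icc 0 sᵢ ∪ segment ℝ (ΓH sᵢ) ⟨c₀.re - r / 2, ys⟩ ∪ segment ℝ ⟨c₀.re - r / 2, ys⟩ ⟨c₀.re + r / 2, ys⟩ ∪
        segment ℝ ⟨c₀.re + r / 2, ys⟩ (ΓH sₒ) ∪ ΓH '' Icc sₒ 1))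
    (hdisjB : Disjoint (ΓH '' Icc 0 sᵢ ∪ segment ℝ (ΓH sᵢ) ⟨c₀.re - r / 2, ys⟩ ∪ segment ℝ ⟨c₀.re + r / 2, ys⟩ (ΓH sₒ) ∪ ΓH '' Icc sₒ 1)
      (ΓV '' Icc 0 tᵢ ∪ segment ℝ (ΓV tᵢ) ⟨xs, c₀.im - r / 2⟩ ∪ segment ℝ ⟨xs, c₀.im - r / 2⟩ ⟨xs, c₀.im + r / 2⟩ ∪
        segment ℝ ⟨xs, c₀.im + r / 2⟩ (ΓV tₒ) ∪ ΓV '' Icc tₒ 1))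
    (hA234 : segment ℝ (ΓV tᵢ) ⟨xs, c₀.im - r / 2⟩ ∪ segment ℝ ⟨xs, c₀.im - r / 2⟩ ⟨xs, c₀.im + r / 2⟩ ∪
      segment ℝ ⟨xs, c₀.im + r / 2⟩ (ΓV tₒ) ⊆ closedBall c₀ r)
    (hB234 : segment ℝ (ΓH sᵢ) ⟨c₀.re - r / 2, ys⟩ ∪ segment ℝ ⟨c₀.re - r / 2, ys⟩ ⟨c₀.re + r / 2, ys⟩ ∪
      segment ℝ ⟨c₀.re + r / 2, ys⟩ (ΓH sₒ) ⊆ closedBall c₀ r)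
    (hVarc : ∀ t ∈ Icc (0 : ℝ) 1, ΓV t ∉ R.arc 0 ∧ ΓV t ∉ R.arc 2)
    {Et Eb M : ℝ → ℂ} (hEtc : ContinuousOn Et (Icc 1 2)) (hEbc : ContinuousOn Eb (Icc 1 2)) (hMc : ContinuousOn M (Icc 0 1))
    (hEt1 : Et 1 = ΓV 1) (hEb1 : Eb 1 = ΓV 0) (hEt : ∀ t ∈ Ioc (1 : ℝ) 2, Et t ∈ (closure R.carrier)ᶜ)
    (hEb : ∀ t ∈ Ioc (1 : ℝ) 2, Eb t ∈ (closure R.carrier)ᶜ) (hM : ∀ s ∈ Icc (0 : ℝ) 1, M s ∈ (closure R.carrier)ᶜ) :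
    ∃ η₀ > 0,
      (∀ x ∈ ΓV '' Icc 0 tᵢ ∪ segment ℝ (ΓV tᵢ) ⟨xs, c₀.im - r / 2⟩ ∪ segment ℝ ⟨xs, c₀.im + r / 2⟩ (ΓV tₒ) ∪ ΓV '' Icc tₒ 1,
        ∀ y ∈ ΓH '' Icc 0 sᵢ ∪ segment ℝ (ΓH sᵢ) ⟨c₀.re - r / 2, ys⟩ ∪ segment ℝ ⟨c₀.re - r / 2, ys⟩ ⟨c₀.re + r / 2, ys⟩ ∪
          segment ℝ ⟨c₀.re + r / 2, ys⟩ (ΓH sₒ) ∪ ΓH '' Icc sₒ 1, η₀ < dist x y) ∧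
      (∀ x ∈ ΓH '' Icc 0 sᵢ ∪ segment ℝ (ΓH sᵢ) ⟨c₀.re - r / 2, ys⟩ ∪ segment ℝ ⟨c₀.re + r / 2, ys⟩ (ΓH sₒ) ∪ ΓH '' Icc sₒ 1,
        ∀ y ∈ ΓV '' Icc 0 tᵢ ∪ segment ℝ (ΓV tᵢ) ⟨xs, c₀.im - r / 2⟩ ∪ segment ℝ ⟨xs, c₀.im - r / 2⟩ ⟨xs, c₀.im + r / 2⟩ ∪
          segment ℝ ⟨xs, c₀.im + r / 2⟩ (ΓV tₒ) ∪ ΓV '' Icc tₒ 1, η₀ < dist x y) ∧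
      (∀ x ∈ R.arc 0 ∪ R.arc 2,
        ∀ y ∈ ΓV '' Icc 0 tᵢ ∪ segment ℝ (ΓV tᵢ) ⟨xs, c₀.im - r / 2⟩ ∪ segment ℝ ⟨xs, c₀.im - r / 2⟩ ⟨xs, c₀.im + r / 2⟩ ∪
          segment ℝ ⟨xs, c₀.im + r / 2⟩ (ΓV tₒ) ∪ ΓV '' Icc tₒ 1, η₀ < dist x y) ∧
      (∀ z ∈ R.arc 0 ∪ R.arc 2, η₀ < dist z (ΓV 0) ∧ η₀ < dist z (ΓV 1)) ∧
      (∀ z ∈ ΓH '' Icc 0 sᵢ ∪ segment ℝ (ΓH sᵢ) ⟨c₀.re - r / 2, ys⟩ ∪ segment ℝ ⟨c₀.re - r / 2, ys⟩ ⟨c₀.re + r / 2, ys⟩ ∪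
          segment ℝ ⟨c₀.re + r / 2, ys⟩ (ΓH sₒ) ∪ ΓH '' Icc sₒ 1, η₀ < dist z (ΓV 0) ∧ η₀ < dist z (ΓV 1)) ∧
      (∀ x ∈ Et '' Icc 1 2 ∪ M '' Icc 0 1 ∪ Eb '' Icc 1 2,
        ∀ y ∈ ΓH '' Icc 0 sᵢ ∪ segment ℝ (ΓH sᵢ) ⟨c₀.re - r / 2, ys⟩ ∪ segment ℝ ⟨c₀.re - r / 2, ys⟩ ⟨c₀.re + r / 2, ys⟩ ∪
          segment ℝ ⟨c₀.re + r / 2, ys⟩ (ΓH sₒ) ∪ ΓH '' Icc sₒ 1, η₀ < dist x y) ∧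
      (∀ x ∈ Et '' Icc 1 2 ∪ M '' Icc 0 1 ∪ Eb '' Icc 1 2, ∀ y ∈ R.arc 0 ∪ R.arc 2, η₀ < dist x y) := by
  have hfrΩ : ∀ z ∈ frontier R.carrier, z ∉ R.carrier := fun z hz hzΩ =>
    Set.disjoint_left.1 R.disjoint_carrier_frontier hzΩ hz
  obtain ⟨σb, hσb, hqb⟩ := hV0
  obtain ⟨σt, hσt, hqt⟩ := hV1
  obtain ⟨σH0, hσH0, hH0eq⟩ := hH0
  obtain ⟨σH1, hσH1, hH1eq⟩ := hH1
  set qb := ΓV 0 with hqbdef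
  set qt := ΓV 1 with hqtdef
  have hqbfr : qb ∈ frontier R.carrier := by rw [hqb]; exact R.boundary_mem_frontier _
  have hqtfr : qt ∈ frontier R.carrier := by rw [hqt]; exact R.boundary_mem_frontier _
  -- the points of the cross
  set Qvm : ℂ := ⟨xs, c₀.im - r / 2⟩ with hQvm
  set Qvp : ℂ := ⟨xs, c₀.im + r / 2⟩ with hQvp
  set Qhm : ℂ := ⟨c₀.re - r / 2, ys⟩ with hQhm
  set Qhp : ℂ := ⟨c₀.re + r / 2, ys⟩ with hQhp
  -- the pieces
  set A1 : Set ℂ := ΓV '' Icc 0 tᵢ with hA1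
  set A2 : Set ℂ := segment ℝ (ΓV tᵢ) Qvm with hA2
  set A3 : Set ℂ := segment ℝ Qvm Qvp with hA3
  set A4 : Set ℂ := segment ℝ Qvp (ΓV tₒ) with hA4
  set A5 : Set ℂ := ΓV '' Icc tₒ 1 with hA5
  set B1 : Set ℂ := ΓH '' Icc 0 sᵢ with hB1
  set B2 : Set ℂ := segment ℝ (ΓH sᵢ) Qhm with hB2
  set B3 : Set ℂ := segment ℝ Qhm Qhp with hB3
  set B4 : Set ℂ := segment ℝ Qhp (ΓH sₒ) with hB4
  set B5 : Set ℂ := ΓH '' Icc sₒ 1 with hB5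
  set Aout : Set ℂ := A1 ∪ A2 ∪ A4 ∪ A5 with hAout
  set Aall : Set ℂ := A1 ∪ A2 ∪ A3 ∪ A4 ∪ A5 with hAall
  set Bout : Set ℂ := B1 ∪ B2 ∪ B4 ∪ B5 with hBout
  set Ball : Set ℂ := B1 ∪ B2 ∪ B3 ∪ B4 ∪ B5 with hBall
  have hA3sub : A3 ⊆ Aall := fun z hz => Or.inl (Or.inl (Or.inr hz))
  have hAoutsub : Aout ⊆ Aall := by
    rintro z (((h | h) | h) | h)
    · exact Or.inl (Or.inl (Or.inl (Or.inl h)))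
    · exact Or.inl (Or.inl (Or.inl (Or.inr h)))
    · exact Or.inl (Or.inr h)
    · exact Or.inr h
  have hB3sub : B3 ⊆ Ball := fun z hz => Or.inl (Or.inl (Or.inr hz))
  have hBoutsub : Bout ⊆ Ball := by
    rintro z (((h | h) | h) | h)
    · exact Or.inl (Or.inl (Or.inl (Or.inl h)))
    · exact Or.inl (Or.inl (Or.inl (Or.inr h)))
    · exact Or.inl (Or.inr h)
    · exact Or.inr h
  -- compactness
  have hIcc1 : ∀ {u v : ℝ}, 0 ≤ u → v ≤ 1 → Icc u v ⊆ Icc 0 1 := fun hu hv => Icc_subset_Icc hu hv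
  have hA1c : IsCompact A1 := (isCompact_Icc.image_of_continuousOn (hVc.mono (hIcc1 le_rfl (htᵢₒ.le.trans htₒ.le))))
  have hA5c : IsCompact A5 := (isCompact_Icc.image_of_continuousOn (hVc.mono (hIcc1 (htᵢ.le.trans htᵢₒ.le) le_rfl)))
  have hB1c : IsCompact B1 := (isCompact_Icc.image_of_continuousOn (hHc.mono (hIcc1 le_rfl (hsᵢₒ.le.trans hsₒ.le))))
  have hB5c : IsCompact B5 := (isCompact_Icc.image_of_continuousOn (hHc.mono (hIcc1 (hsᵢ.le.trans hsᵢₒ.le) le_rfl)))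
  have hsegc : ∀ P Q : ℂ, IsCompact (segment ℝ P Q) := fun P Q => by
    rw [segment_eq_image_lineMap]; exact isCompact_Icc.image AffineMap.lineMap_continuous
  have hAoutc : IsCompact Aout := ((hA1c.union (hsegc _ _)).union (hsegc _ _)).union hA5c
  have hAallc : IsCompact Aall := (((hA1c.union (hsegc _ _)).union (hsegc _ _)).union (hsegc _ _)).union hA5c
  have hBoutc : IsCompact Bout := ((hB1c.union (hsegc _ _)).union (hsegc _ _)).union hB5c
  have hBallc : IsCompact Ball := (((hB1c.union (hsegc _ _)).union (hsegc _ _)).union (hsegc _ _)).union hB5c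
  -- where the pieces live
  have hVcl : ∀ t ∈ Icc (0 : ℝ) 1, ΓV t ∈ closure R.carrier := by
    intro t ht
    rcases ht.1.eq_or_lt with h | h
    · rw [← h]; exact frontier_subset_closure hqbfr
    rcases ht.2.lt_or_eq with h' | h'
    · exact subset_closure (hVΩ t ⟨h, h'⟩)
    · rw [h']; exact frontier_subset_closure hqtfr
  have hH0fr : ΓH 0 ∈ frontier R.carrier := by rw [hH0eq]; exact R.boundary_mem_frontier _
  have hH1fr : ΓH 1 ∈ frontier R.carrier := by rw [hH1eq]; exact R.boundary_mem_frontier _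
  have hHcl : ∀ s ∈ Icc (0 : ℝ) 1, ΓH s ∈ closure R.carrier := by
    intro s hs
    rcases hs.1.eq_or_lt with h | h
    · rw [← h]; exact frontier_subset_closure hH0fr
    rcases hs.2.lt_or_eq with h' | h'
    · exact subset_closure (hHΩ s ⟨h, h'⟩)
    · rw [h']; exact frontier_subset_closure hH1fr
  have hballcl : closedBall c₀ r ⊆ closure R.carrier := hballΩ.trans subset_closure
  have hAall_cl : Aall ⊆ closure R.carrier := by
    rintro z ((((⟨t, ht, rfl⟩ | h) | h) | h) | ⟨t, ht, rfl⟩)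
    · exact hVcl t (hIcc1 le_rfl (htᵢₒ.le.trans htₒ.le) ht)
    · exact hballcl (hA234 (Or.inl (Or.inl h)))
    · exact hballcl (hA234 (Or.inl (Or.inr h)))
    · exact hballcl (hA234 (Or.inr h))
    · exact hVcl t (hIcc1 (htᵢ.le.trans htᵢₒ.le) le_rfl ht)
  have hBall_cl : Ball ⊆ closure R.carrier := by
    rintro z ((((⟨t, ht, rfl⟩ | h) | h) | h) | ⟨t, ht, rfl⟩)
    · exact hHcl t (hIcc1 le_rfl (hsᵢₒ.le.trans hsₒ.le) ht)
    · exact hballcl (hB234 (Or.inl (Or.inl h)))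
    · exact hballcl (hB234 (Or.inl (Or.inr h)))
    · exact hballcl (hB234 (Or.inr h))
    · exact hHcl t (hIcc1 (hsᵢ.le.trans hsᵢₒ.le) le_rfl ht)
  -- the frontier points of the pieces
  have hAall_fr : ∀ z ∈ Aall, z ∈ frontier R.carrier → z = qb ∨ z = qt := by
    rintro z ((((⟨t, ht, rfl⟩ | h) | h) | h) | ⟨t, ht, rfl⟩) hz
    · rcases ht.1.eq_or_lt with h | h
      · exact Or.inl (by rw [← h])
      · exact (hfrΩ _ hz (hVΩ t ⟨h, ht.2.trans_lt (htᵢₒ.trans htₒ)⟩)).elim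
    · exact (hfrΩ _ hz (hballΩ (hA234 (Or.inl (Or.inl h))))).elim
    · exact (hfrΩ _ hz (hballΩ (hA234 (Or.inl (Or.inr h))))).elim
    · exact (hfrΩ _ hz (hballΩ (hA234 (Or.inr h)))).elim
    · rcases ht.2.lt_or_eq with h | h
      · exact (hfrΩ _ hz (hVΩ t ⟨(htᵢ.trans htᵢₒ).trans_le ht.1, h⟩)).elim
      · exact Or.inr (by rw [h])
  have hBall_fr : ∀ z ∈ Ball, z ∈ frontier R.carrier → z = ΓH 0 ∨ z = ΓH 1 := by
    rintro z ((((⟨t, ht, rfl⟩ | h) | h) | h) | ⟨t, ht, rfl⟩) hz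
    · rcases ht.1.eq_or_lt with h | h
      · exact Or.inl (by rw [← h])
      · exact (hfrΩ _ hz (hHΩ t ⟨h, ht.2.trans_lt (hsᵢₒ.trans hsₒ)⟩)).elim
    · exact (hfrΩ _ hz (hballΩ (hB234 (Or.inl (Or.inl h))))).elim
    · exact (hfrΩ _ hz (hballΩ (hB234 (Or.inl (Or.inr h))))).elim
    · exact (hfrΩ _ hz (hballΩ (hB234 (Or.inr h)))).elim
    · rcases ht.2.lt_or_eq with h | h
      · exact (hfrΩ _ hz (hHΩ t ⟨(hsᵢ.trans hsᵢₒ).trans_le ht.1, h⟩)).elim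
      · exact Or.inr (by rw [h])
  -- `qb, qt` are not on the arcs `0, 2` nor on the `B`-pieces; `ΓH 0, ΓH 1` are on the arcs `0 ∪ 2`
  have hqarc : qb ∉ R.arc 0 ∧ qb ∉ R.arc 2 ∧ qt ∉ R.arc 0 ∧ qt ∉ R.arc 2 :=
    ⟨(hVarc 0 ⟨le_rfl, zero_le_one⟩).1, (hVarc 0 ⟨le_rfl, zero_le_one⟩).2, (hVarc 1 ⟨zero_le_one, le_rfl⟩).1, (hVarc 1 ⟨zero_le_one, le_rfl⟩).2⟩
  have hHarc : (ΓH 0 ∈ R.arc 0 ∨ ΓH 0 ∈ R.arc 2) ∧ (ΓH 1 ∈ R.arc 0 ∨ ΓH 1 ∈ R.arc 2) := by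
    have h0' : ΓH 0 ∈ R.arc jL := by rw [hH0eq]; exact ⟨σH0, Ioo_subset_Icc_self hσH0, rfl⟩
    have h1' : ΓH 1 ∈ R.arc jR := by rw [hH1eq]; exact ⟨σH1, Ioo_subset_Icc_self hσH1, rfl⟩
    rcases hLR with ⟨rfl, rfl⟩ | ⟨rfl, rfl⟩
    · exact ⟨Or.inl h0', Or.inr h1'⟩
    · exact ⟨Or.inr h0', Or.inl h1'⟩
  have hq_notB : qb ∉ Ball ∧ qt ∉ Ball := by
    constructor
    · intro h
      rcases hBall_fr _ h hqbfr with h' | h'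
      · rcases hHarc.1 with h'' | h'' <;> [exact hqarc.1 (h' ▸ h''); exact hqarc.2.1 (h' ▸ h'')]
      · rcases hHarc.2 with h'' | h'' <;> [exact hqarc.1 (h' ▸ h''); exact hqarc.2.1 (h' ▸ h'')]
    · intro h
      rcases hBall_fr _ h hqtfr with h' | h'
      · rcases hHarc.1 with h'' | h'' <;> [exact hqarc.2.2.1 (h' ▸ h''); exact hqarc.2.2.2 (h' ▸ h'')]
      · rcases hHarc.2 with h'' | h'' <;> [exact hqarc.2.2.1 (h' ▸ h''); exact hqarc.2.2.2 (h' ▸ h'')]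
  -- ### separation constants
  -- (1) `Aout` vs `Ball`, (2) `Bout` vs `Aall`
  obtain ⟨η₁, hη₁, hsep₁⟩ := exists_pos_forall_lt_dist hAoutc hBallc.isClosed hdisjA
  obtain ⟨η₂, hη₂, hsep₂⟩ := exists_pos_forall_lt_dist hBoutc hAallc.isClosed hdisjB
  -- (3) the arcs `0 ∪ 2` vs `Aall`
  have harcc : IsCompact (R.arc 0 ∪ R.arc 2) := (R.isCompact_arc 0).union (R.isCompact_arc 2)
  have hdisj3 : Disjoint (R.arc 0 ∪ R.arc 2) Aall := by
    rw [Set.disjoint_left]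
    rintro z hz hzA
    have hzfr : z ∈ frontier R.carrier := hz.elim (fun h => R.arc_subset_frontier 0 h) (fun h => R.arc_subset_frontier 2 h)
    rcases hAall_fr z hzA hzfr with rfl | rfl
    · exact hz.elim hqarc.1 hqarc.2.1
    · exact hz.elim hqarc.2.2.1 hqarc.2.2.2
  obtain ⟨η₃, hη₃, hsep₃⟩ := exists_pos_forall_lt_dist harcc hAallc.isClosed hdisj3
  -- (4) distances from `qb, qt` to the arcs `0 ∪ 2` and to `Ball`
  have hd₁ : ∃ d₁ > 0, ∀ z ∈ R.arc 0 ∪ R.arc 2, d₁ < dist z qb ∧ d₁ < dist z qt := by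
    have h1 : Disjoint (R.arc 0 ∪ R.arc 2) {qb, qt} := by
      rw [Set.disjoint_left]
      rintro z hz (rfl | rfl)
      · exact hz.elim hqarc.1 hqarc.2.1
      · exact hz.elim hqarc.2.2.1 hqarc.2.2.2
    obtain ⟨d, hd, hsep⟩ := exists_pos_forall_lt_dist harcc (Set.toFinite _).isClosed h1
    exact ⟨d, hd, fun z hz => ⟨hsep z hz qb (by simp), hsep z hz qt (by simp)⟩⟩
  obtain ⟨d₁, hd₁, hd₁sep⟩ := hd₁
  have hd₂ : ∃ d₂ > 0, ∀ z ∈ Ball, d₂ < dist z qb ∧ d₂ < dist z qt := by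
    have h1 : Disjoint Ball {qb, qt} := by
      rw [Set.disjoint_left]
      rintro z hz (rfl | rfl)
      · exact hq_notB.1 hz
      · exact hq_notB.2 hz
    obtain ⟨d, hd, hsep⟩ := exists_pos_forall_lt_dist hBallc (Set.toFinite _).isClosed h1
    exact ⟨d, hd, fun z hz => ⟨hsep z hz qb (by simp), hsep z hz qt (by simp)⟩⟩
  obtain ⟨d₂, hd₂, hd₂sep⟩ := hd₂
  -- (5) the exterior closing curves vs `Ball` and vs the arcs
  set Ext : Set ℂ := Et '' Icc 1 2 ∪ M '' Icc 0 1 ∪ Eb '' Icc 1 2 with hExt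
  have hExtc : IsCompact Ext :=
    ((isCompact_Icc.image_of_continuousOn hEtc).union (isCompact_Icc.image_of_continuousOn hMc)).union
      (isCompact_Icc.image_of_continuousOn hEbc)
  have hExt_mem : ∀ z ∈ Ext, z ∈ (closure R.carrier)ᶜ ∨ z = qt ∨ z = qb := by
    rintro z ((⟨t, ht, rfl⟩ | ⟨t, ht, rfl⟩) | ⟨t, ht, rfl⟩)
    · rcases ht.1.eq_or_lt with h | h
      · exact Or.inr (Or.inl (by rw [← h, hEt1]))
      · exact Or.inl (hEt t ⟨h, ht.2⟩)
    · exact Or.inl (hM t ht)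
    · rcases ht.1.eq_or_lt with h | h
      · exact Or.inr (Or.inr (by rw [← h, hEb1]))
      · exact Or.inl (hEb t ⟨h, ht.2⟩)
  have hExt_notΩ : ∀ z ∈ Ext, z ∉ R.carrier := by
    intro z hz hzΩ
    rcases hExt_mem z hz with h | rfl | rfl
    · exact h (subset_closure hzΩ)
    · exact hfrΩ _ hqtfr hzΩ
    · exact hfrΩ _ hqbfr hzΩ
  have hdisj5 : Disjoint Ext Ball := by
    rw [Set.disjoint_left]
    intro z hz hzB
    rcases hExt_mem z hz with h | rfl | rfl
    · exact h (hBall_cl hzB)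
    · exact hq_notB.2 hzB
    · exact hq_notB.1 hzB
  obtain ⟨η₅, hη₅, hsep₅⟩ := exists_pos_forall_lt_dist hExtc hBallc.isClosed hdisj5
  have hdisj6 : Disjoint Ext (R.arc 0 ∪ R.arc 2) := by
    rw [Set.disjoint_left]
    intro z hz hzA
    rcases hExt_mem z hz with h | rfl | rfl
    · exact h (frontier_subset_closure (hzA.elim (fun h => R.arc_subset_frontier 0 h) (fun h => R.arc_subset_frontier 2 h)))
    · exact hzA.elim hqarc.2.2.1 hqarc.2.2.2
    · exact hzA.elim hqarc.1 hqarc.2.1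
  obtain ⟨η₆, hη₆, hsep₆⟩ := exists_pos_forall_lt_dist hExtc harcc.isClosed hdisj6
  -- ### the constant
  set η₀ : ℝ := min (min (min η₁ η₂) (min η₃ η₅)) (min (min η₆ (d₁ / 2)) (d₂ / 2)) with hη₀
  have h1 : η₀ ≤ η₁ := (min_le_left _ _).trans ((min_le_left _ _).trans (min_le_left _ _))
  have h2 : η₀ ≤ η₂ := (min_le_left _ _).trans ((min_le_left _ _).trans (min_le_right _ _))
  have h3 : η₀ ≤ η₃ := (min_le_left _ _).trans ((min_le_right _ _).trans (min_le_left _ _))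
  have h5 : η₀ ≤ η₅ := (min_le_left _ _).trans ((min_le_right _ _).trans (min_le_right _ _))
  have h6 : η₀ ≤ η₆ := (min_le_right _ _).trans ((min_le_left _ _).trans (min_le_left _ _))
  have h7 : η₀ ≤ d₁ / 2 := (min_le_right _ _).trans ((min_le_left _ _).trans (min_le_right _ _))
  have h8 : η₀ ≤ d₂ / 2 := (min_le_right _ _).trans (min_le_right _ _)
  refine ⟨η₀, by positivity, fun x hx y hy => h1.trans_lt (hsep₁ x hx y hy), fun x hx y hy => h2.trans_lt (hsep₂ x hx y hy),
    fun x hx y hy => h3.trans_lt (hsep₃ x hx y hy), fun z hz => ?_, fun z hz => ?_,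
    fun x hx y hy => h5.trans_lt (hsep₅ x hx y hy), fun x hx y hy => h6.trans_lt (hsep₆ x hx y hy)⟩
  · exact ⟨by linarith [(hd₁sep z hz).1], by linarith [(hd₁sep z hz).2]⟩
  · exact ⟨by linarith [(hd₂sep z hz).1], by linarith [(hd₂sep z hz).2]⟩

end KirchhoffSlope

end Summit.CriticalPhenomena.CardyFormulaZ2.Theorems
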